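import Literature.Computability.AlgebraicComplexity.BD17WronskianCriterionProofs
import Mathlib.LinearAlgebra.Vandermonde
import Mathlib.Analysis.SpecialFunctions.ExpDeriv
import HarnessLib

/-!
# The exponentials `e^{λ_1 x}, …, e^{λ_n x}` form a Descartes system (Pólya–Szegő V 91, V 77)

THEOREMS ONLY (0 definitions, 0 named facts). G. Pólya, G. Szegő, *Problems and Theorems in
Analysis II* [PolyaSzego1998], Part V, Chap. 1: problem **91** ("Verify that the criterion 87 is
satisfied by the functions `e^{λ_1 x}, e^{λ_2 x}, …, e^{λ_n x}`", solution p. 227: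
`W(e^{λ_1 x}, …, e^{λ_n x}) = e^{(λ_1 + ⋯ + λ_n)x} ∏_{j<k} (λ_k − λ_j) > 0`) and, through problem 90
(= Bihan–Dickenstein 2017 Prop. 4.2, the tree's `BD2017_prop_4_2_holds`), the inequality half of
problem **77** (§6 "Laguerre's Proof of Descartes' Rule of Signs": for real `a_1, …, a_n` and
`λ_1 < ⋯ < λ_n`, the number `Z` of real zeros of `F(x) = a_1e^{λ_1x} + ⋯ + a_ne^{λ_nx}` and the
number `C` of changes of sign of `a_1, …, a_n` satisfy "`C − Z` is a non-negative even integer" —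
here `Z ≤ C`, zeros counted with multiplicity; the parity assertion of 77 is NOT formalised:
`-- TODO(general form): C − Z even`). Held text
`book:polya1998-problems-theorems-analysis-ii-theory-functions-zeros` (p0079 problem 77, p0083
problem 91, p0241 solution 91).

Purpose (cell `val-lit`, row X4-BD17, LADDER-VALIANT V1 ideation): a non-vacuity witness for the
typed criterion `BD2017_prop_4_2` (a concrete family meeting its Wronskian hypotheses, so that the
discharged equivalence is seen to have content) and the base case of the Descartes/fewnomial bounds
for sums of exponentials = sums of real powers. Honest framing: classical (Laguerre 1883); nothing
here bears on VP versus VNP.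

* `BD17.wronskian_exp_const_mul` — solution 91: the Wronskian of `x ↦ e^{λ_j x}` is
  `e^{(Σ λ_j) y} · ∏_{i<j} (λ_j − λ_i)` (Vandermonde);
* `BD17.wronskian_exp_const_mul_pos` — it is positive for `λ` strictly increasing;
* `BD17.satisfiesDescartesRule_exp` — problems 90 + 91: the exponentials satisfy Descartes' rule of
  signs on `ℝ` (with multiplicity, Def. 4.1 of BD 2017);
* `BD17.rootCountMult_expSum_le_signVar` — problem 77 (inequality half) unfolded: `Z ≤ C`.

## References

* [PolyaSzego1998] G. Pólya, G. Szegő, *Problems and Theorems in Analysis II*, Springer Classics in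
  Mathematics (1998 printing), doi:10.1007/978-3-642-61905-2: Part V problems 77, 87, 90, 91.
* [BihanDickenstein2017] F. Bihan, A. Dickenstein, IMRN 2017 (22) 6867–6893; arXiv:1601.05826,
  §4.1 Def. 4.1, Prop. 4.2.
-/

noncomputable section

open Set Finset Matrix
open Literature.Algebra.Polynomial (signVar)

namespace Literature.Computability.AlgebraicComplexity

namespace BD17

/-- **Pólya–Szegő, solution 91:** `W(e^{λ_1 x}, …, e^{λ_n x})(y) = e^{(λ_1+⋯+λ_n) y} ∏_{j<k} (λ_k − λ_j)`
(a Vandermonde determinant). [cite: PolyaSzego1998, Part V §7 solution 91] -/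
theorem wronskian_exp_const_mul {s : ℕ} (lam : Fin s → ℝ) (y : ℝ) :
    wronskian (fun i x => Real.exp (lam i * x)) y =
      Real.exp ((∑ i, lam i) * y) * ∏ i : Fin s, ∏ j ∈ Finset.Ioi i, (lam j - lam i) := by
  unfold wronskian
  have hM : (Matrix.of fun i j : Fin s => iteratedDeriv i.val (fun x => Real.exp (lam j * x)) y) =
      Matrix.of fun i j : Fin s => Real.exp (lam j * y) * (Matrix.vandermonde lam)ᵀ i j := by
    ext i j
    simp only [Matrix.of_apply, iteratedDeriv_exp_const_mul, Matrix.transpose_apply,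
      Matrix.vandermonde_apply]
    ring
  rw [hM, Matrix.det_mul_row, Matrix.det_transpose, Matrix.det_vandermonde, Finset.sum_mul,
    Real.exp_sum]

/-- For `λ_1 < ⋯ < λ_n` the Wronskian of the exponentials is positive ("`> 0`", solution 91).
[cite: PolyaSzego1998, Part V §7 solution 91] -/
theorem wronskian_exp_const_mul_pos {s : ℕ} (lam : Fin s → ℝ) (hlam : StrictMono lam) (y : ℝ) :
    0 < wronskian (fun i x => Real.exp (lam i * x)) y := by
  rw [wronskian_exp_const_mul]
  refine mul_pos (Real.exp_pos _) (Finset.prod_pos fun i _ => Finset.prod_pos fun j hj => ?_)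
  exact sub_pos.mpr (hlam (Finset.mem_Ioi.mp hj))

/-- **Pólya–Szegő V 91** ("the criterion 87 is satisfied by the functions `e^{λ_1 x}, …, e^{λ_n x}`"):
for `λ` strictly increasing, every Wronskian of an increasing subfamily of the exponentials is
nonvanishing on `ℝ`, and two of the same size have positive product.
[cite: PolyaSzego1998, Part V §7 problem 91] -/
theorem wronskian_conditions_exp {s : ℕ} (lam : Fin s → ℝ) (hlam : StrictMono lam) :
    (∀ (ℓ : ℕ) (J : Fin ℓ → Fin s), StrictMono J →
        ∀ y ∈ (Set.univ : Set ℝ), wronskian (fun b => (fun i x => Real.exp (lam i * x)) (J b)) y ≠ 0) ∧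
      (∀ (ℓ : ℕ) (J J' : Fin ℓ → Fin s), StrictMono J → StrictMono J' →
        ∀ y ∈ (Set.univ : Set ℝ), 0 < wronskian (fun b => (fun i x => Real.exp (lam i * x)) (J b)) y *
          wronskian (fun b => (fun i x => Real.exp (lam i * x)) (J' b)) y) := by
  refine ⟨fun ℓ J hJ y _ => ?_, fun ℓ J J' hJ hJ' y _ => ?_⟩
  · exact (wronskian_exp_const_mul_pos (fun b => lam (J b)) (hlam.comp hJ) y).ne'
  · exact mul_pos (wronskian_exp_const_mul_pos (fun b => lam (J b)) (hlam.comp hJ) y)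
      (wronskian_exp_const_mul_pos (fun b => lam (J' b)) (hlam.comp hJ') y)

/-- **Pólya–Szegő V 90 + 91 (Laguerre):** for `λ_1 < ⋯ < λ_n` the exponentials
`e^{λ_1 x}, …, e^{λ_n x}` satisfy Descartes' rule of signs on `ℝ` (BD 2017 Def. 4.1, zeros counted
with multiplicity) — by the discharged criterion `BD2017_prop_4_2_holds`.
[cite: PolyaSzego1998, Part V §7 problems 90, 91] -/
theorem satisfiesDescartesRule_exp {s : ℕ} (lam : Fin s → ℝ) (hlam : StrictMono lam) :
    SatisfiesDescartesRule (fun i x => Real.exp (lam i * x)) (Set.univ : Set ℝ) := by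
  have han : ∀ i, AnalyticOnNhd ℝ (fun x => Real.exp (lam i * x)) (Set.univ : Set ℝ) :=
    fun i x _ => (analyticAt_const.mul analyticAt_id).rexp'
  exact (BD2017_prop_4_2_holds s (fun i x => Real.exp (lam i * x)) Set.univ isOpen_univ
    isConnected_univ han).mpr (wronskian_conditions_exp lam hlam)

/-- **Pólya–Szegő V 77, inequality half** (§6, Laguerre's proof of Descartes' rule): for real
`a_1, …, a_n` not all zero and `λ_1 < λ_2 < ⋯ < λ_n`, the entire function
`F(x) = a_1e^{λ_1x} + ⋯ + a_ne^{λ_nx}` has finitely many real zeros, and their number `Z` counted with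
multiplicity is at most the number `C` of changes of sign of `a_1, …, a_n`. (Print: "`C − Z` is a
non-negative even integer"; the parity is not formalised here.)
[cite: PolyaSzego1998, Part V §6 problem 77] -/
theorem rootCountMult_expSum_le_signVar {s : ℕ} (lam : Fin s → ℝ) (hlam : StrictMono lam)
    (a : Fin s → ℝ) (ha : a ≠ 0) :
    {x | x ∈ (Set.univ : Set ℝ) ∧ linComb a (fun i x => Real.exp (lam i * x)) x = 0}.Finite ∧
      rootCountMult (linComb a (fun i x => Real.exp (lam i * x))) (Set.univ : Set ℝ) ≤
        signVar (List.ofFn a) :=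
  -- TODO(general form): `C − Z` is even (Pólya–Szegő V 77), from the signs of `F` at `±∞`.
  satisfiesDescartesRule_exp lam hlam a ha

end BD17

end Literature.Computability.AlgebraicComplexity
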